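import Summits.Parity.GeneralizedHardyLittlewood.Theorems.LeeYangFibresRelativeDimOnePairRigidityWeightedDefs
import Summits.Parity.GeneralizedHardyLittlewood.Theorems.LeeYangFibresRelativeDimOnePairRigidityDecayTools
import HarnessLib

/-!
# Reshaped pair-slice rigidity, WEIGHTED form — part 1, TOOLS

Context (seat c1, crux stmt-Parity-14113, line `gallagher-backwards-split`): the registered `stub_rigidity` is FALSE
(`Cruxes/RelativeDimOne/StubRigidityFalse-c1.md`); the reshaped pair-slice rigidity `pairRigidityWithDecay` (decay
`C/φ(d)`) is landed in `…PairRigidityDecay*.lean`.  The reshaped PAIR line needs the decay measured by a general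
Hardy–Littlewood weight `ρ` — e.g. `ρ(d) = Π_{p∣d} p/(p−1)²`, the divisor form of the twin singular-series spectrum,
for which `G_ρ(h) = Σ_{d∣h} ρ(d) ≍ h/φ(h) ≍ 𝔖(h)+1` but `ρ(d)` is NOT `O(1/φ(d))`.  This series (`…Weighted{Defs,Tools,Main,}`)
proves the WEIGHTED statement `pairRigidityWeighted` by the same elementary argument.

This file: `G_ρ ≥ 0`, monotone along divisibility, `G_ρ(1) = 1`; product formulas `G_ρ(ΠS) = Π(1+ρ(p))`,
`R_ρ(ΠS) = Π(1 + ρ(p)/p)` for prime sets; the weighted `w`-rough tail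
`Σ_{d ∣ Π_{w<p≤M} p, d ≠ 1} ρ(d)/d ≤ e^{c₀/w} − 1 ≤ 2c₀/w` for `w ≥ c₀` (hook `roughTailWeightedHook`).
-/

noncomputable section

open scoped BigOperators
open Finset Real

namespace Summit.Parity.GeneralizedHardyLittlewood.Cruxes.RelativeDimOne.RigidityC1

variable {ρ : ℕ → ℝ} {c₀ : ℝ}

/-! ### `G_ρ` : positivity, monotonicity, product formula -/

/-- Every term of `G_ρ` is nonnegative. -/
theorem wDivSum_nonneg (hρ : IsHLWeight ρ c₀) (n : ℕ) : 0 ≤ wDivSum ρ n :=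
  Finset.sum_nonneg fun d _ => hρ.nonneg d

/-- `G_ρ` is monotone along divisibility. -/
theorem wDivSum_mono (hρ : IsHLWeight ρ c₀) {m n : ℕ} (hmn : m ∣ n) (hn : n ≠ 0) :
    wDivSum ρ m ≤ wDivSum ρ n := by
  unfold wDivSum
  exact Finset.sum_le_sum_of_subset_of_nonneg (Nat.divisors_subset_of_dvd hn hmn)
    fun d _ _ => hρ.nonneg d

/-- `G_ρ(1) = 1`. -/
theorem wDivSum_one (hρ : IsHLWeight ρ c₀) : wDivSum ρ 1 = 1 := by
  simp [wDivSum, hρ.map_one]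

/-- `1 ≤ G_ρ(n)` for `n ≠ 0`. -/
theorem one_le_wDivSum (hρ : IsHLWeight ρ c₀) {n : ℕ} (hn : n ≠ 0) : 1 ≤ wDivSum ρ n := by
  have h1 : wDivSum ρ 1 ≤ wDivSum ρ n := wDivSum_mono hρ (one_dvd n) hn
  rwa [wDivSum_one hρ] at h1

/-- Product formula: for a finite set `S` of primes, `G_ρ(Π S) = Π_{p ∈ S} (1 + ρ(p))`. -/
theorem wDivSum_prod_primes (hρ : IsHLWeight ρ c₀) (S : Finset ℕ) (hS : ∀ p ∈ S, p.Prime) :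
    wDivSum ρ (∏ p ∈ S, p) = ∏ p ∈ S, (1 + ρ p) := by
  classical
  induction S using Finset.induction_on with
  | empty => simp [wDivSum, hρ.map_one]
  | insert p S hpS ih =>
    have hp : p.Prime := hS p (Finset.mem_insert_self p S)
    have hS' : ∀ q ∈ S, q.Prime := fun q hq => hS q (Finset.mem_insert_of_mem hq)
    rw [Finset.prod_insert hpS, Finset.prod_insert hpS]
    have hcop : Nat.Coprime p (∏ q ∈ S, q) := by
      refine Nat.Coprime.prod_right fun q hq => ?_
      have hq' : q.Prime := hS' q hq
      have hne : p ≠ q := fun h => hpS (h ▸ hq)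
      exact (Nat.coprime_primes hp hq').mpr hne
    unfold wDivSum
    rw [Literature.NumberTheory.Sieve.sum_divisors_mul_of_coprime hcop]
    rw [hp.divisors]
    have h1p : (1 : ℕ) ≠ p := hp.one_lt.ne
    rw [Finset.sum_pair h1p]
    simp only [one_mul]
    have ih' := ih hS'
    unfold wDivSum at ih'
    rw [ih']
    have hsum : ∑ b ∈ (∏ q ∈ S, q).divisors, ρ (p * b) = ρ p * ∑ b ∈ (∏ q ∈ S, q).divisors, ρ b := by
      rw [Finset.mul_sum]
      refine Finset.sum_congr rfl fun b hb => ?_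
      have hbdvd : b ∣ ∏ q ∈ S, q := Nat.dvd_of_mem_divisors hb
      have hcopb : Nat.Coprime p b := hcop.coprime_dvd_right hbdvd
      rw [hρ.map_mul p b hcopb]
    rw [hsum, ih']
    ring

/-- Product formula: for a finite set `S` of primes, `R_ρ(Π S) = Π_{p ∈ S} (1 + ρ(p)/p)`. -/
theorem rwDivSum_prod_primes (hρ : IsHLWeight ρ c₀) (S : Finset ℕ) (hS : ∀ p ∈ S, p.Prime) :
    rwDivSum ρ (∏ p ∈ S, p) = ∏ p ∈ S, (1 + ρ p / p) := by
  classical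
  induction S using Finset.induction_on with
  | empty => simp [rwDivSum, hρ.map_one]
  | insert p S hpS ih =>
    have hp : p.Prime := hS p (Finset.mem_insert_self p S)
    have hS' : ∀ q ∈ S, q.Prime := fun q hq => hS q (Finset.mem_insert_of_mem hq)
    rw [Finset.prod_insert hpS, Finset.prod_insert hpS]
    have hcop : Nat.Coprime p (∏ q ∈ S, q) := by
      refine Nat.Coprime.prod_right fun q hq => ?_
      have hq' : q.Prime := hS' q hq
      have hne : p ≠ q := fun h => hpS (h ▸ hq)
      exact (Nat.coprime_primes hp hq').mpr hne
    unfold rwDivSum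
    rw [Literature.NumberTheory.Sieve.sum_divisors_mul_of_coprime hcop]
    rw [hp.divisors]
    have h1p : (1 : ℕ) ≠ p := hp.one_lt.ne
    rw [Finset.sum_pair h1p]
    simp only [one_mul]
    have ih' := ih hS'
    unfold rwDivSum at ih'
    rw [ih']
    have hp0 : (p : ℝ) ≠ 0 := by exact_mod_cast hp.ne_zero
    have hsum : ∑ b ∈ (∏ q ∈ S, q).divisors, ρ (p * b) / ((p * b : ℕ) : ℝ) =
        (ρ p / p) * ∑ b ∈ (∏ q ∈ S, q).divisors, ρ b / b := by
      rw [Finset.mul_sum]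
      refine Finset.sum_congr rfl fun b hb => ?_
      have hbdvd : b ∣ ∏ q ∈ S, q := Nat.dvd_of_mem_divisors hb
      have hcopb : Nat.Coprime p b := hcop.coprime_dvd_right hbdvd
      rw [hρ.map_mul p b hcopb, Nat.cast_mul]
      rw [div_mul_div_comm]
    rw [hsum, ih']
    ring

/-! ### The `w₀`-rough tail -/

/-- `R_ρ(Π_{w < p ≤ M} p) ≤ exp(c₀/w)`. -/
theorem rwDivSum_roughPrimorial_le (hρ : IsHLWeight ρ c₀) {w : ℕ} (hw : 1 ≤ w) (M : ℕ) :
    rwDivSum ρ (roughPrimorial w M) ≤ Real.exp (c₀ / w) := by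
  unfold roughPrimorial
  rw [rwDivSum_prod_primes hρ _ (fun p hp => (Finset.mem_filter.1 hp).2)]
  have hc₀ : 0 ≤ c₀ := le_trans zero_le_one hρ.one_le
  refine (Real.prod_one_add_le_exp_sum _ ?_).trans ?_
  · intro p
    by_cases hp0 : p = 0
    · rw [hp0]; simp
    · exact div_nonneg (hρ.nonneg p) (Nat.cast_nonneg p)
  · refine Real.exp_le_exp.mpr ?_
    calc ∑ p ∈ (Ioc w M).filter Nat.Prime, ρ p / p
        ≤ ∑ p ∈ (Ioc w M).filter Nat.Prime, c₀ * (1 / ((p : ℝ) * ((p : ℝ) - 1))) := by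
          refine Finset.sum_le_sum fun p hp => ?_
          have hpp : p.Prime := (Finset.mem_filter.1 hp).2
          have hp2 : (2 : ℝ) ≤ p := by exact_mod_cast hpp.two_le
          have hp0 : (0 : ℝ) < p := by linarith
          have hp1 : (0 : ℝ) < (p : ℝ) - 1 := by linarith
          calc ρ p / p ≤ (c₀ / ((p : ℝ) - 1)) / p :=
                div_le_div_of_nonneg_right (hρ.prime_le p hpp) hp0.le
            _ = c₀ * (1 / ((p : ℝ) * ((p : ℝ) - 1))) := by
                field_simp
      _ = c₀ * ∑ p ∈ (Ioc w M).filter Nat.Prime, (1 / ((p : ℝ) * ((p : ℝ) - 1))) := by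
          rw [Finset.mul_sum]
      _ ≤ c₀ * ∑ n ∈ Ioc w M, (1 : ℝ) / ((n : ℝ) * ((n : ℝ) - 1)) := by
          refine mul_le_mul_of_nonneg_left ?_ hc₀
          refine Finset.sum_le_sum_of_subset_of_nonneg (Finset.filter_subset _ _) ?_
          intro n hn _
          have hn1 : (1 : ℝ) + 1 ≤ n := by
            have : w + 1 ≤ n := (Finset.mem_Ioc.1 hn).1
            have : 2 ≤ n := by omega
            exact_mod_cast this
          have : (0 : ℝ) < (n : ℝ) * ((n : ℝ) - 1) := by nlinarith
          positivity
      _ ≤ c₀ * (1 / w) := mul_le_mul_of_nonneg_left (sum_Ioc_inv_mul_pred_le hw M) hc₀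
      _ = c₀ / w := by ring

/-- The weighted `w`-rough tail: `Σ_{d ∣ Π_{w<p≤M} p, d ≠ 1} ρ(d)/d ≤ exp(c₀/w) − 1 ≤ 2c₀/w` (for `w ≥ c₀`). -/
theorem sum_rough_divisors_weighted_le (hρ : IsHLWeight ρ c₀) {w : ℕ} (hw : 1 ≤ w) (hcw : c₀ ≤ w)
    (M : ℕ) : ∑ d ∈ (roughPrimorial w M).divisors.erase 1, ρ d / d ≤ 2 * c₀ / w := by
  have h1 : (1 : ℕ) ∈ (roughPrimorial w M).divisors :=
    Nat.one_mem_divisors.2 (roughPrimorial_pos w M).ne'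
  have hsplit := Finset.sum_erase_add (roughPrimorial w M).divisors (fun d => ρ d / d) h1
  have htot : ∑ d ∈ (roughPrimorial w M).divisors, ρ d / d ≤ Real.exp (c₀ / w) :=
    rwDivSum_roughPrimorial_le hρ hw M
  simp only [Nat.cast_one, div_one, hρ.map_one] at hsplit
  have hc₀ : 0 ≤ c₀ := le_trans zero_le_one hρ.one_le
  have hw0 : (0 : ℝ) < w := by exact_mod_cast hw
  have hy0 : (0 : ℝ) ≤ c₀ / w := by positivity
  have hexp : Real.exp (c₀ / (w : ℝ)) - 1 ≤ 2 * c₀ / w := by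
    have hw1 : |c₀ / (w : ℝ)| ≤ 1 := by
      rw [abs_of_nonneg hy0]
      exact (div_le_one hw0).mpr hcw
    have h1 := Real.abs_exp_sub_one_le hw1
    have h2 : Real.exp (c₀ / (w : ℝ)) - 1 ≤ |Real.exp (c₀ / (w : ℝ)) - 1| := le_abs_self _
    rw [abs_of_nonneg hy0] at h1
    have h3 : (2 : ℝ) * (c₀ / w) = 2 * c₀ / w := by ring
    linarith
  linarith


/-- Registered hook (stmt-Parity-14113, seat c1): the weighted `w`-rough tail, `∀`-form of
`sum_rough_divisors_weighted_le`. -/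
theorem roughTailWeightedHook : ∀ (ρ : ℕ → ℝ) (c₀ : ℝ) (w M : ℕ), IsHLWeight ρ c₀ → 1 ≤ w → c₀ ≤ w →
    ∑ d ∈ (roughPrimorial w M).divisors.erase 1, ρ d / d ≤ 2 * c₀ / w :=
  fun _ _ _ M hρ hw hcw => sum_rough_divisors_weighted_le hρ hw hcw M

end Summit.Parity.GeneralizedHardyLittlewood.Cruxes.RelativeDimOne.RigidityC1
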